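import Summits.AnomalousDissipation.AnomalousDissipation.Theorems.MomentParityMomentLadderPhaseLaw
import Mathlib.Dynamics.BirkhoffSum.Average
import Mathlib.MeasureTheory.Integral.DominatedConvergence
import Mathlib.MeasureTheory.Integral.Prod

/-!
# Crux `MomentParity.MomentLadder` (stmt-AnomalousDissipation-11463), line `Sketch`, one-trajectory currency —
# ONE-STEP TIME MEANS along the Galerkin semiflow: continuity, Birkhoff sums, space averages, tail bounds

For a continuous observable `G` of the phase space `↥(galerkinSubspace (freqBall N))` and the Galerkin semiflow
`Φ t = galerkinPhaseFlow ν ĝ t`, the ONE-STEP TIME MEAN `Ḡ x = ∫₀¹ G (Φ s x) ds` is the observable whose Birkhoff sums under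
the time-one map are the time integrals of `G` along the orbit; this is how the (discrete) pointwise ergodic theorem of the
literature (`Literature.Dynamics.Ergodic.birkhoff_ergodic_theorem_holds`) reads continuous-time averages.

* `continuous_timeMean` — `Ḡ` is continuous (joint continuity of the semiflow, parametric integrals);
* `birkhoffSum_timeMean`, `birkhoffAverage_timeMean` — `Σ_{k<n} Ḡ (Φ₁^[k] x) = ∫₀ⁿ G (Φ t x) dt`;
* `integral_timeMean_eq` — for a `Φ`-invariant probability law with confined orbits, `∫ Ḡ dm = ∫ G dm` (Fubini + invariance);
* `setIntegral_timeMean_le` — the tail bound `∫_A Ḡ dm ≤ M·m(A) + ∫ (G − M)₊ dm` on every measurable `A` (equal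
  distribution of `G ∘ Φ s` under `m`), the form in which uniform integrability of `G` controls `Ḡ` on small sets.

Folklore (Krylov–Bogoliubov; Foias–Manley–Rosa–Temam 2001 Ch. IV §2–3).
-/

set_option linter.dupNamespace false

noncomputable section

namespace Summit.AnomalousDissipation.AnomalousDissipation.Theorems.MomentLadder

open MeasureTheory Filter Topology Set Function UnitAddTorus intervalIntegral
open scoped ENNReal
open Literature.Analysis.FunctionSpaces Literature.Analysis.FluidPDE

section TimeMean

variable {N : ℕ} {ν : ℝ} {g : ↥(Torus.freqBall (d := Fin 3) N) → EuclideanSpace ℂ (Fin 3)}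

/-- The integrand of the one-step time mean, made globally continuous in `(x, s)` by `s ↦ max s 0`. [folklore] -/
theorem continuous_obs_galerkinPhaseFlow_max (hν : 0 ≤ ν) (hg : Torus.IsRealCoeff g)
    {G : ↥(galerkinSubspace (Torus.freqBall (d := Fin 3) N)) → ℝ} (hG : Continuous G) :
    Continuous fun p : ↥(galerkinSubspace (Torus.freqBall (d := Fin 3) N)) × ℝ => G (galerkinPhaseFlow ν g (max p.2 0) p.1) :=
  hG.comp ((continuous_galerkinPhaseFlow_max hν hg).comp (continuous_snd.prodMk continuous_fst))

/-- On `[0, T]` (`T ≥ 0`) the `max`-regularised integrand is the orbit observable. [folklore] -/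
theorem obs_max_eq_of_mem_uIcc {G : ↥(galerkinSubspace (Torus.freqBall (d := Fin 3) N)) → ℝ}
    (x : ↥(galerkinSubspace (Torus.freqBall (d := Fin 3) N))) {T : ℝ} (hT : 0 ≤ T) {s : ℝ} (hs : s ∈ uIcc 0 T) :
    G (galerkinPhaseFlow ν g (max s 0) x) = G (galerkinPhaseFlow ν g s x) := by
  rw [uIcc_of_le hT] at hs
  rw [max_eq_left hs.1]

/-- The orbit observable `t ↦ G (Φ t x)` is interval integrable on every `[a, b] ⊆ [0, ∞)`. [folklore] -/
theorem intervalIntegrable_obs (hν : 0 ≤ ν) (hg : Torus.IsRealCoeff g)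
    {G : ↥(galerkinSubspace (Torus.freqBall (d := Fin 3) N)) → ℝ} (hG : Continuous G)
    (x : ↥(galerkinSubspace (Torus.freqBall (d := Fin 3) N))) {a b : ℝ} (ha : 0 ≤ a) (hb : 0 ≤ b) :
    IntervalIntegrable (fun t => G (galerkinPhaseFlow ν g t x)) volume a b := by
  have hc : Continuous fun t : ℝ => G (galerkinPhaseFlow ν g (max t 0) x) :=
    (continuous_obs_galerkinPhaseFlow_max hν hg hG).comp (continuous_const.prodMk continuous_id)
  refine (hc.intervalIntegrable a b).congr fun t ht => ?_
  have ht0 : 0 ≤ t := by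
    rcases le_total a b with hab | hab
    · rw [uIoc_of_le hab] at ht; exact ha.trans ht.1.le
    · rw [uIoc_of_ge hab] at ht; exact hb.trans ht.1.le
  show G (galerkinPhaseFlow ν g (max t 0) x) = G (galerkinPhaseFlow ν g t x)
  rw [max_eq_left ht0]

/-- **The one-step time mean `Ḡ x = ∫₀¹ G (Φ s x) ds` of a continuous observable is continuous.** [folklore] -/
theorem continuous_timeMean (hν : 0 ≤ ν) (hg : Torus.IsRealCoeff g)
    {G : ↥(galerkinSubspace (Torus.freqBall (d := Fin 3) N)) → ℝ} (hG : Continuous G) :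
    Continuous fun x : ↥(galerkinSubspace (Torus.freqBall (d := Fin 3) N)) =>
      ∫ s in (0 : ℝ)..1, G (galerkinPhaseFlow ν g s x) := by
  have h := intervalIntegral.continuous_parametric_intervalIntegral_of_continuous' (μ := volume)
    (f := fun (x : ↥(galerkinSubspace (Torus.freqBall (d := Fin 3) N))) (s : ℝ) => G (galerkinPhaseFlow ν g (max s 0) x))
    (continuous_obs_galerkinPhaseFlow_max hν hg hG) 0 1
  refine h.congr fun x => integral_congr fun s hs => ?_
  exact obs_max_eq_of_mem_uIcc x zero_le_one hs

/-- **Birkhoff sums of the one-step time mean are time integrals**: `Σ_{k<n} Ḡ (Φ₁^[k] x) = ∫₀ⁿ G (Φ t x) dt`. [folklore] -/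
theorem birkhoffSum_timeMean (hν : 0 ≤ ν) (hg : Torus.IsRealCoeff g)
    {G : ↥(galerkinSubspace (Torus.freqBall (d := Fin 3) N)) → ℝ} (hG : Continuous G) (n : ℕ)
    (x : ↥(galerkinSubspace (Torus.freqBall (d := Fin 3) N))) :
    birkhoffSum (galerkinPhaseFlow ν g 1) (fun y => ∫ s in (0 : ℝ)..1, G (galerkinPhaseFlow ν g s y)) n x =
      ∫ t in (0 : ℝ)..(n : ℝ), G (galerkinPhaseFlow ν g t x) := by
  rw [birkhoffSum]
  have hk : ∀ k : ℕ, (∫ s in (0 : ℝ)..1, G (galerkinPhaseFlow ν g s ((galerkinPhaseFlow ν g 1)^[k] x))) =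
      ∫ t in (k : ℝ)..((k : ℝ) + 1), G (galerkinPhaseFlow ν g t x) := by
    intro k
    rw [galerkinPhaseFlow_one_iterate hν hg k x]
    have h1 : (∫ s in (0 : ℝ)..1, G (galerkinPhaseFlow ν g s (galerkinPhaseFlow ν g (k : ℝ) x))) =
        ∫ s in (0 : ℝ)..1, G (galerkinPhaseFlow ν g (s + k) x) := by
      refine integral_congr fun s hs => ?_
      rw [uIcc_of_le zero_le_one] at hs
      show G (galerkinPhaseFlow ν g s (galerkinPhaseFlow ν g (k : ℝ) x)) = G (galerkinPhaseFlow ν g (s + k) x)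
      rw [galerkinPhaseFlow_add' hν hg hs.1 (Nat.cast_nonneg k)]
    rw [h1, intervalIntegral.integral_comp_add_right (fun t => G (galerkinPhaseFlow ν g t x)) (k : ℝ), zero_add, add_comm]
  simp_rw [hk]
  have hadj := sum_integral_adjacent_intervals (f := fun t => G (galerkinPhaseFlow ν g t x)) (μ := volume)
    (a := fun k : ℕ => (k : ℝ)) (n := n) fun k _ => ?_
  · simpa using hadj
  · simpa using intervalIntegrable_obs hν hg hG x (Nat.cast_nonneg k) (by positivity : (0 : ℝ) ≤ (k : ℝ) + 1)

/-- **Birkhoff averages of the one-step time mean are running time means**: `A_n Ḡ (x) = n⁻¹ ∫₀ⁿ G (Φ t x) dt`. [folklore] -/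
theorem birkhoffAverage_timeMean (hν : 0 ≤ ν) (hg : Torus.IsRealCoeff g)
    {G : ↥(galerkinSubspace (Torus.freqBall (d := Fin 3) N)) → ℝ} (hG : Continuous G) (n : ℕ)
    (x : ↥(galerkinSubspace (Torus.freqBall (d := Fin 3) N))) :
    birkhoffAverage ℝ (galerkinPhaseFlow ν g 1) (fun y => ∫ s in (0 : ℝ)..1, G (galerkinPhaseFlow ν g s y)) n x =
      (n : ℝ)⁻¹ * ∫ t in (0 : ℝ)..(n : ℝ), G (galerkinPhaseFlow ν g t x) := by
  rw [birkhoffAverage, birkhoffSum_timeMean hν hg hG n x, smul_eq_mul]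

/-! ### Space averages: invariance and confinement -/

variable {m : Measure ↥(galerkinSubspace (Torus.freqBall (d := Fin 3) N))}

/-- A confined continuous observable has a bounded, hence integrable, one-step time mean. [folklore] -/
theorem integrable_timeMean [IsFiniteMeasure m] (hν : 0 ≤ ν) (hg : Torus.IsRealCoeff g)
    {G : ↥(galerkinSubspace (Torus.freqBall (d := Fin 3) N)) → ℝ} (hG : Continuous G) {C : ℝ}
    (hC : ∀ᵐ x ∂m, ∀ s, 0 ≤ s → |G (galerkinPhaseFlow ν g s x)| ≤ C) :
    Integrable (fun x => ∫ s in (0 : ℝ)..1, G (galerkinPhaseFlow ν g s x)) m := by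
  refine (integrable_const (max C 0)).mono' (continuous_timeMean hν hg hG).aestronglyMeasurable ?_
  filter_upwards [hC] with x hx
  rw [Real.norm_eq_abs]
  calc |∫ s in (0 : ℝ)..1, G (galerkinPhaseFlow ν g s x)| ≤ ∫ s in (0 : ℝ)..1, |G (galerkinPhaseFlow ν g s x)| :=
        abs_integral_le_integral_abs zero_le_one
    _ ≤ ∫ _ in (0 : ℝ)..1, max C 0 := by
        refine integral_mono_on zero_le_one ((intervalIntegrable_obs hν hg hG x le_rfl zero_le_one).abs)
          intervalIntegrable_const fun s hs => (hx s hs.1).trans (le_max_left _ _)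
    _ = max C 0 := by simp

/-- An observable bounded along confined orbits is integrable (the time-`0` instance of the confinement bound). [folklore] -/
theorem integrable_obs_of_confined [IsFiniteMeasure m]
    {G : ↥(galerkinSubspace (Torus.freqBall (d := Fin 3) N)) → ℝ} (hG : Continuous G) {C : ℝ}
    (hC : ∀ᵐ x ∂m, ∀ s, 0 ≤ s → |G (galerkinPhaseFlow ν g s x)| ≤ C) : Integrable G m := by
  refine (integrable_const C).mono' hG.aestronglyMeasurable ?_
  filter_upwards [hC] with x hx
  have h := hx 0 le_rfl
  rwa [galerkinPhaseFlow_zero, ← Real.norm_eq_abs] at h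

/-- **The space average of the time mean is the space average**: for a probability law `m` invariant under `Φ s`
(`0 ≤ s`) and a continuous observable bounded along `m`-a.e. forward orbit, `∫ Ḡ dm = ∫ G dm`. [folklore] -/
theorem integral_timeMean_eq [IsProbabilityMeasure m] (hν : 0 ≤ ν) (hg : Torus.IsRealCoeff g)
    (hinv : ∀ s, 0 ≤ s → m.map (galerkinPhaseFlow ν g s) = m)
    {G : ↥(galerkinSubspace (Torus.freqBall (d := Fin 3) N)) → ℝ} (hG : Continuous G) {C : ℝ}
    (hC : ∀ᵐ x ∂m, ∀ s, 0 ≤ s → |G (galerkinPhaseFlow ν g s x)| ≤ C) :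
    ∫ x, (∫ s in (0 : ℝ)..1, G (galerkinPhaseFlow ν g s x)) ∂m = ∫ x, G x ∂m := by
  -- the globally continuous integrand
  set F : ↥(galerkinSubspace (Torus.freqBall (d := Fin 3) N)) → ℝ → ℝ := fun x s =>
    G (galerkinPhaseFlow ν g (max s 0) x) with hF
  have hFc : Continuous (uncurry F) := continuous_obs_galerkinPhaseFlow_max hν hg hG
  have h1 : ∀ x, (∫ s in (0 : ℝ)..1, G (galerkinPhaseFlow ν g s x)) = ∫ s in Ioc (0 : ℝ) 1, F x s := by
    intro x
    rw [← integral_of_le zero_le_one]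
    exact integral_congr fun s hs => (obs_max_eq_of_mem_uIcc x zero_le_one hs).symm
  simp_rw [h1]
  -- integrability on the product
  have hint : Integrable (uncurry F) (m.prod (volume.restrict (Ioc (0 : ℝ) 1))) := by
    haveI : IsFiniteMeasure (volume.restrict (Ioc (0 : ℝ) 1)) := ⟨by simp⟩
    refine (integrable_const C).mono' hFc.aestronglyMeasurable ?_
    refine (Measure.ae_prod_iff_ae_ae ?_).2 ?_
    · exact (isClosed_le hFc.norm continuous_const).measurableSet
    · filter_upwards [hC] with x hx
      exact ae_of_all _ fun s => by rw [Real.norm_eq_abs]; exact hx _ (le_max_right _ _)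
  rw [integral_integral_swap hint]
  -- invariance at each time
  have h2 : ∀ s ∈ Ioc (0 : ℝ) 1, ∫ x, F x s ∂m = ∫ x, G x ∂m := by
    intro s hs
    have hs0 : 0 ≤ s := hs.1.le
    have hΦ : Measurable (galerkinPhaseFlow ν g s :
        ↥(galerkinSubspace (Torus.freqBall (d := Fin 3) N)) → ↥(galerkinSubspace (Torus.freqBall (d := Fin 3) N))) :=
      (continuous_galerkinPhaseFlow_of_nonneg hν hg hs0).measurable
    simp only [hF, max_eq_left hs0]
    rw [← integral_map hΦ.aemeasurable hG.aestronglyMeasurable, hinv s hs0]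
  rw [setIntegral_congr_fun measurableSet_Ioc h2]
  simp

/-- **Tail bound for time means on small sets.** For a probability law `m` invariant under `Φ s` (`0 ≤ s`), a continuous
observable `G` bounded along `m`-a.e. forward orbit, a measurable `A` and a level `M`:
`∫_A Ḡ dm ≤ M·m(A) + ∫ (G − M)₊ dm` (pointwise `G ≤ M + (G − M)₊` along the orbit, then `∫ P̄ dm = ∫ P dm` for
`P = (G − M)₊`). [folklore] -/
theorem setIntegral_timeMean_le [IsProbabilityMeasure m] (hν : 0 ≤ ν) (hg : Torus.IsRealCoeff g)
    (hinv : ∀ s, 0 ≤ s → m.map (galerkinPhaseFlow ν g s) = m)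
    {G : ↥(galerkinSubspace (Torus.freqBall (d := Fin 3) N)) → ℝ} (hG : Continuous G) {C : ℝ}
    (hC : ∀ᵐ x ∂m, ∀ s, 0 ≤ s → |G (galerkinPhaseFlow ν g s x)| ≤ C) {A : Set ↥(galerkinSubspace (Torus.freqBall (d := Fin 3) N))}
    (hA : MeasurableSet A) (M : ℝ) :
    ∫ x in A, (∫ s in (0 : ℝ)..1, G (galerkinPhaseFlow ν g s x)) ∂m ≤
      M * m.real A + ∫ x, max (G x - M) 0 ∂m := by
  set P : ↥(galerkinSubspace (Torus.freqBall (d := Fin 3) N)) → ℝ := fun y => max (G y - M) 0 with hP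
  have hPc : Continuous P := (hG.sub continuous_const).max continuous_const
  have hPC : ∀ᵐ x ∂m, ∀ s, 0 ≤ s → |P (galerkinPhaseFlow ν g s x)| ≤ C + |M| := by
    filter_upwards [hC] with x hx s hs
    have h := hx s hs
    have hC0 : 0 ≤ C := (abs_nonneg _).trans h
    have hGle : G (galerkinPhaseFlow ν g s x) ≤ C := (le_abs_self _).trans h
    have hP0 : 0 ≤ P (galerkinPhaseFlow ν g s x) := le_max_right _ _
    have hP1 : P (galerkinPhaseFlow ν g s x) ≤ C + |M| := by
      refine max_le ?_ (by positivity)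
      linarith [neg_abs_le M]
    rw [abs_of_nonneg hP0]
    exact hP1
  -- pointwise along the orbit: `Ḡ x ≤ M + P̄ x`
  have hpt : ∀ x, (∫ s in (0 : ℝ)..1, G (galerkinPhaseFlow ν g s x)) ≤
      M + ∫ s in (0 : ℝ)..1, P (galerkinPhaseFlow ν g s x) := by
    intro x
    have hI := intervalIntegrable_obs hν hg hG x le_rfl zero_le_one
    have hIP := intervalIntegrable_obs hν hg hPc x le_rfl zero_le_one
    calc (∫ s in (0 : ℝ)..1, G (galerkinPhaseFlow ν g s x))
        ≤ ∫ s in (0 : ℝ)..1, (M + P (galerkinPhaseFlow ν g s x)) := by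
          refine integral_mono_on zero_le_one hI (intervalIntegrable_const.add hIP) fun s _ => ?_
          have : G (galerkinPhaseFlow ν g s x) - M ≤ P (galerkinPhaseFlow ν g s x) := le_max_left _ _
          linarith
      _ = M + ∫ s in (0 : ℝ)..1, P (galerkinPhaseFlow ν g s x) := by
          rw [integral_add intervalIntegrable_const hIP]
          simp
  have hGbar := integrable_timeMean hν hg hG hC
  have hPbar := integrable_timeMean hν hg hPc hPC
  have hPbar0 : ∀ x, 0 ≤ ∫ s in (0 : ℝ)..1, P (galerkinPhaseFlow ν g s x) := fun x =>
    integral_nonneg zero_le_one fun s _ => le_max_right _ _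
  calc ∫ x in A, (∫ s in (0 : ℝ)..1, G (galerkinPhaseFlow ν g s x)) ∂m
      ≤ ∫ x in A, (M + ∫ s in (0 : ℝ)..1, P (galerkinPhaseFlow ν g s x)) ∂m :=
        setIntegral_mono_on hGbar.integrableOn ((integrable_const M).add hPbar).integrableOn hA fun x _ => hpt x
    _ = M * m.real A + ∫ x in A, (∫ s in (0 : ℝ)..1, P (galerkinPhaseFlow ν g s x)) ∂m := by
        rw [integral_add (integrable_const M).integrableOn hPbar.integrableOn, setIntegral_const, smul_eq_mul, mul_comm]
    _ ≤ M * m.real A + ∫ x, (∫ s in (0 : ℝ)..1, P (galerkinPhaseFlow ν g s x)) ∂m := by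
        exact add_le_add_right (setIntegral_le_integral hPbar (Eventually.of_forall hPbar0)) _
    _ = M * m.real A + ∫ x, max (G x - M) 0 ∂m := by rw [integral_timeMean_eq hν hg hinv hPc hPC]

/-- **Deliverable (registered): running time means of an orbit observable are Birkhoff averages of its one-step time mean**
(`ν ≥ 0`, real force coefficients, continuous observable). [folklore] -/
theorem timeMean_birkhoffAverage :
    ∀ (N : ℕ) (ν : ℝ) (g : ↥(Torus.freqBall (d := Fin 3) N) → EuclideanSpace ℂ (Fin 3)), 0 ≤ ν → Torus.IsRealCoeff g →
    ∀ (G : ↥(galerkinSubspace (Torus.freqBall (d := Fin 3) N)) → ℝ), Continuous G →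
    ∀ (n : ℕ) (x : ↥(galerkinSubspace (Torus.freqBall (d := Fin 3) N))),
      (n : ℝ)⁻¹ * ∫ t in (0 : ℝ)..(n : ℝ), G (galerkinPhaseFlow ν g t x) =
        birkhoffAverage ℝ (galerkinPhaseFlow ν g 1) (fun y => ∫ s in (0 : ℝ)..1, G (galerkinPhaseFlow ν g s y)) n x := by
  intro N ν g hν hg G hG n x
  exact (birkhoffAverage_timeMean hν hg hG n x).symm

end TimeMean

end Summit.AnomalousDissipation.AnomalousDissipation.Theorems.MomentLadder

end
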